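import Summits.SmoothPoincare4.SmoothPoincare4.Theorems.SoloInformedSchoenfliesBall
import HarnessLib
import HarnessLib.Audit.Tags

/-!
# SPC4 from the Poincaré-ball EMBEDDING conjecture and the Schoenflies conjecture

Solo informed SmoothPoincare4, session 18.  A sharpening of the landed path theorem
`smoothPoincare4_of_poincareBallDouble_of_schoenfliesBall` (`SoloInformedFiveDimensionalRoute.lean`):
its first hypothesis, Gabai's Poincaré-ball *double* conjecture (Conj. 13.1 in the form of Remarks
13.2 (i): `D(Δ) ≅ S⁴`), is weakened to the Poincaré-ball *embedding* conjecture
`PoincareBallEmbeddingConjecture` (`SoloInformedGabaiPoincareBalls.lean`): every Hausdorff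
second-countable smooth Poincaré 4-ball smoothly embeds in the round `S⁴`.  The double conjecture
implies the embedding conjecture (`poincareBallEmbeddingConjecture_of_doubleConjecture`); the converse
is not known.

Sources.  D. Gabai, *The 4-dimensional light bulb theorem …* is not used; D. Gabai, *3-Spheres in the
4-sphere and pseudo-isotopies of `S¹ × S³`*, arXiv:2212.02004 (2022), §13 p. 62: *"SPC4 follows from
the Schoenflies conjecture and the Poincaré ball embedding conjecture"*; J. Hass and R. Kirby,
*Characterizing the 4-sphere, `S⁴`*, J. Open Math. Problems 1 (1) (2025) 52–68, §4 p. 62: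
Lemma 4.1 (*"The smooth Schoenflies Conjecture is true if the smooth Poincaré Conjecture is true"*)
and Question 4.2 (*"Does every smooth homotopy 4-ball with `S³` boundary smoothly embed in `S⁴`?"*,
followed by *"The converse would be true if the following question had an affirmative answer"*).
What is reproduced here is exactly that converse: (Question 4.2, affirmative) + (Schoenflies, ball
form) + (`Γ₄ = 0`, Cerf 1968) ⟹ SPC4, with the puncturing of the homotopy sphere, the
contractibility of the punctured manifold, the transfer of the gluing and the twisted-sphere
assembly taken from `SoloInformedFiveDimensionalRoute.lean` (all proved there).

Main theorems: `smoothPoincare4_of_poincareBallEmbedding_of_schoenfliesBall` (inline Schoenflies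
hypothesis) and `smoothPoincare4_of_poincareBallEmbedding_of_schoenfliesBallConjecture` (named
hypotheses `PoincareBallEmbeddingConjecture`, `SchoenfliesBallConjectureFour`,
`cerf_twistedSphere_four`).  The previously landed double-conjecture form is the special case
`hE := poincareBallEmbeddingConjecture_of_doubleConjecture _ hD` (see the closing comment).
No new axioms, no `sorry`; nothing here discharges any of the three hypotheses.
-/

noncomputable section

open scoped Manifold ContDiff Topology
open Set Function ContinuousMap

namespace Summit.SmoothPoincare4.SmoothPoincare4.Theorems

open Literature.Topology.FourManifolds

/-- **SPC4 from the Poincaré-ball embedding conjecture and the Schoenflies conjecture (ball form),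
given `Γ₄ = 0`.**  Hass–Kirby 2025, §4 p. 62 (Lemma 4.1, Question 4.2); Gabai 2022, §13 p. 62.
Proof: a homotopy 4-sphere `M` is compact; puncture it, `M = W ∪_ψ 𝔻⁴` with `W = {a ≤ f}` a regular
superlevel set of a Morse function (`exists_isBoundaryGluing_superlevel_closedBall`); `W` is
contractible (`RegularSublevel.contractibleSpace_superlevel_of_homotopyEquiv_sphere`), so by the
embedding conjecture it embeds in `S⁴`, so by the Schoenflies hypothesis `W ≅ 𝔻⁴`; transporting the
gluing exhibits `M` as a twisted sphere, which is `S⁴` by `Γ₄ = 0`.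
[cite: HassKirby2025, §4 Lemma 4.1 and Question 4.2; Gabai2022, §13 p. 62] -/
theorem smoothPoincare4_of_poincareBallEmbedding_of_schoenfliesBall
    (hE : PoincareBallEmbeddingConjecture)
    (hS : ∀ (W : Type) [TopologicalSpace W] [T2Space W] [SecondCountableTopology W]
      [ChartedSpace (EuclideanHalfSpace (3 + 1)) W] [IsManifold (𝓡∂ (3 + 1)) ∞ W] [CompactSpace W]
      (b : BoundaryData (𝓡∂ (3 + 1)) W (𝓡 3)),
      Nonempty (b.carrier ≃ₘ⟮𝓡 3, 𝓡 3⟯ (Metric.sphere (0 : EuclideanSpace ℝ (Fin (3 + 1))) 1)) →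
      (∃ φ : W → (Metric.sphere (0 : EuclideanSpace ℝ (Fin (3 + 1 + 1))) 1),
        Manifold.IsSmoothEmbedding (𝓡∂ (3 + 1)) (𝓡 (3 + 1)) ∞ φ) →
      Nonempty (W ≃ₘ⟮𝓡∂ (3 + 1), 𝓡∂ (3 + 1)⟯
        (Metric.closedBall (0 : EuclideanSpace ℝ (Fin (3 + 1))) 1)))
    (hC : cerf_twistedSphere_four) : SmoothPoincare4 := by
  intro M _ _ _ _ _ e
  haveI : CompactSpace M := compactSpace_of_homotopyEquiv_sphere (n := 4) (by norm_num) M e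
  obtain ⟨y, hy⟩ := (NormedSpace.sphere_nonempty (E := EuclideanSpace ℝ (Fin (4 + 1)))
    (x := (0 : EuclideanSpace ℝ (Fin (4 + 1)))) (r := (1 : ℝ))).2 zero_le_one
  haveI : Nonempty M := ⟨e.symm.toFun ⟨y, hy⟩⟩
  -- puncture: `M = W ∪_ψ 𝔻⁴`, `W = {a ≤ f}`
  obtain ⟨f, a, h, ψ, G, ⟨Ψ⟩⟩ :=
    exists_isBoundaryGluing_superlevel_closedBall M (k := 3) (by norm_num)
  -- `W` is a Poincaré ball
  haveI : ContractibleSpace (RegularSuperlevel h) :=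
    RegularSublevel.contractibleSpace_superlevel_of_homotopyEquiv_sphere (by norm_num) h Ψ e
  -- it embeds in `S⁴` by the embedding conjecture ...
  obtain ⟨φ, hφ⟩ := hE (RegularSuperlevel h) (RegularSublevel.boundaryData h.const_sub) ⟨ψ⟩
  -- ... so it is a Schoenflies ball, hence a disc
  obtain ⟨g⟩ := hS (RegularSuperlevel h) (RegularSublevel.boundaryData h.const_sub) ⟨ψ⟩ ⟨φ, hφ⟩
  -- `M = 𝔻⁴ ∪_χ 𝔻⁴` is a twisted sphere, diffeomorphic to `S⁴` by Cerf
  have G₃ := IsBoundaryGluing.transfer (b₁ := closedBallBoundaryData 3) g.symm G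
  exact hC (((closedBallBoundaryData 3).restrictDiffeomorph
      (RegularSublevel.boundaryData h.const_sub) g.symm).trans ψ)
    { carrier := M, isTwistedSphere := G₃ }

/-- Named-hypothesis form: **(Poincaré-ball embedding conjecture) → (Schoenflies conjecture, ball
form) → (`Γ₄ = 0`) → SPC4**.  This is the converse direction of Hass–Kirby 2025 Lemma 4.1 made
exact: their Question 4.2 is `PoincareBallEmbeddingConjecture`.
[cite: HassKirby2025, §4 Question 4.2; Gabai2022, §13 p. 62] -/
theorem smoothPoincare4_of_poincareBallEmbedding_of_schoenfliesBallConjecture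
    (hE : PoincareBallEmbeddingConjecture) (hS : SchoenfliesBallConjectureFour)
    (hC : cerf_twistedSphere_four) : SmoothPoincare4 :=
  smoothPoincare4_of_poincareBallEmbedding_of_schoenfliesBall hE hS hC

/- The landed double-conjecture path `smoothPoincare4_of_poincareBallDouble_of_schoenfliesBallConjecture`
(`SoloInformedSchoenfliesBall.lean`) is the special case `hE := poincareBallEmbeddingConjecture_of_doubleConjecture
(fun _ _ _ _ _ _ _ b => exists_isBoundaryGluing_holds b b) hD`; it is not restated here. -/

end Summit.SmoothPoincare4.SmoothPoincare4.Theorems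

end
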